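import Literature.NumberTheory.EllipticCurves.SteinWuthrich2013.SplitUniformizationDataProofs
import Literature.NumberTheory.EllipticCurves.TateCurve.Twist
import Literature.NumberTheory.EllipticCurves.TateCurve.UniformizationSubfield
import Literature.NumberTheory.LocalFields.PadicAlgebraOneUnitHomRigidity
import Mathlib.NumberTheory.Padics.Complex
import HarnessLib

/-!
# An integral isomorphism `C • (W ⊗ ℂ_p) = E_q` at a multiplicative prime
# (Silverman ATAEC Thm. V.5.3, Lemma V.5.2; AEC VII.1.3; proofs only)

Topic `Literature/NumberTheory/EllipticCurves` (cluster `SteinWuthrich2013`); proof file. Cell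
`bsd-eis`, seat `bsd-eis-k5-c4` g3: step N3a of the discharge of the named fact
`SteinWuthrich2013.exists_isMultCanonical` (NON-split multiplicative prime; conjunct `hHn` of
`stub_publishedFacts`, crux 4 `BSDpOnCellC`, stmt-BirchSwinnertonDyer-19034).

At a non-split multiplicative prime `p` the curve `W/ℚ_p` is only the unramified quadratic twist of
the Tate curve `E_q` (`tateJ q = j(W)`); over `ℂ_p` (Mathlib `PadicComplex`, algebraically closed, so
`γ(W/ℂ_p) = −c₄/c₆` is a square) Silverman's Lemma V.5.2 (b) (tree
`TateCurve.iso_tateCurve_of_isSquare_gamma`) gives `C • (W ⊗ ℂ_p) = E_q`. We prove that such a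
`C = (u, r, s, t)` is automatically INTEGRAL for a globally minimal `W` with multiplicative reduction
(`p ≠ 2`): `‖u‖ = 1` from `c₄(E_q) = u⁻⁴c₄(W)` (`‖c₄(W)‖_p = 1` is multiplicative reduction,
`‖E₄(q)‖ = 1`), `‖r‖ ≤ 1` from the `b₆`-transformation formula `4r³ + b₂r² + 2b₄r + b₆ = u⁶b₆'`
(ultrametric), `‖s‖, ‖t‖ ≤ 1` from `a₁' = u⁻¹(a₁ + 2s)`, `a₃' = u⁻³(a₃ + ra₁ + 2t)` (AEC III.1
Table 3.1, VII.1.3).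

* `norm_c₄_eq_one_of_hasMultiplicativeReductionAtPrime` — `‖c₄(W)‖_p = 1` (globally minimal `W`,
  multiplicative reduction at `p`);
* `tateJ_algebraMap_padicComplex` — `tateJ (q : ℂ_p) = (tateJ q : ℂ_p)`;
* `exists_integral_variableChange_padicComplex` — **`∃ C`, `C • (W ⊗ ℂ_p) = E_q` with
  `‖u‖ = 1`, `‖r‖, ‖s‖, ‖t‖ ≤ 1`**.

## Sources
* J. H. Silverman, *Advanced Topics in the Arithmetic of Elliptic Curves* (1994), Lemma V.5.2,
  Thm. V.5.3 (PDF pp. 406–409). [SilvermanATAEC1994]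
* J. H. Silverman, *The Arithmetic of Elliptic Curves* (2009), III.1 Table 3.1, VII.1.3, VII.5.1.
  [SilvermanAEC2009]
* W. Stein, C. Wuthrich, Math. Comp. 82 (2013), §4.2 (non-split case via the unramified quadratic
  extension). [SteinWuthrich2013]
-/

noncomputable section

open scoped Classical

open WeierstrassCurve Literature.NumberTheory.EllipticCurves
  Literature.NumberTheory.EllipticCurves.TateCurve Literature.NumberTheory.LocalFields

namespace Literature.NumberTheory.EllipticCurves.SteinWuthrich2013

variable {W : WeierstrassCurve ℚ} {p : ℕ} [hp : Fact p.Prime]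

/-! ### `‖c₄(W)‖_p = 1` at a multiplicative prime -/

/-- **Multiplicative reduction means `v_p(c₄) = 0` for a minimal model**: for `W/ℚ` globally minimal
with multiplicative reduction at `p`, `‖c₄(W)‖_p = 1`. Mathlib's `HasMultiplicativeReduction` gives it
for its chosen `ℤ_p`-minimal model `(W ⊗ ℚ_p).minimal ℤ_p = C • (W ⊗ ℚ_p)`; `W ⊗ ℚ_p` is itself
`ℤ_p`-minimal (`isMinimal_baseChange_padic_of_isGloballyMinimal`), so both have the same `ord_p Δ`
(`padicValuation_Δ_minimal_eq`), whence `‖u‖ = 1` and `‖c₄‖` agree (AEC VII.1.3 (b), VII.5.1 (b)).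
[cite: SilvermanAEC2009, Prop. VII.5.1(b) and Prop. VII.1.3(b)] -/
theorem norm_c₄_eq_one_of_hasMultiplicativeReductionAtPrime [W.IsElliptic] [W.IsGloballyMinimal]
    (h : W.HasMultiplicativeReductionAtPrime p) : ‖(W.c₄ : ℚ_[p])‖ = 1 := by
  -- index the prime by a place `v` of `ℚ` (for `isMinimal_baseChange_padic_of_isGloballyMinimal`)
  obtain ⟨v, hv⟩ := (Rat.HeightOneSpectrum.primesEquiv (R := NumberField.RingOfIntegers ℚ)).surjective
    ⟨p, Fact.out⟩
  have hvp : ((Rat.HeightOneSpectrum.primesEquiv v : Nat.Primes) : ℕ) = p :=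
    congrArg Subtype.val hv
  subst hvp
  set ℓ : ℕ := ((Rat.HeightOneSpectrum.primesEquiv v : Nat.Primes) : ℕ) with hℓ
  set E : WeierstrassCurve ℚ_[ℓ] := W.baseChange ℚ_[ℓ] with hE
  haveI hEmin : E.IsMinimal ℤ_[ℓ] := isMinimal_baseChange_padic_of_isGloballyMinimal W v
  set Wm : WeierstrassCurve ℚ_[ℓ] := E.minimal ℤ_[ℓ] with hWm
  have hmul : Wm.HasMultiplicativeReduction ℤ_[ℓ] := h
  haveI : Wm.IsMinimal ℤ_[ℓ] := hmul.toIsMinimal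
  -- `‖c₄(Wm)‖ = 1`
  obtain ⟨rc, hrc⟩ : ∃ r : ℤ_[ℓ], (r : ℚ_[ℓ]) = Wm.c₄ := ⟨_, integralModel_c₄_eq ℤ_[ℓ] Wm⟩
  have hc₄ := hmul.multiplicativeReduction
  rw [← hrc, ← PadicInt.algebraMap_apply,
    IsDedekindDomain.HeightOneSpectrum.valuation_eq_one_iff_notMem] at hc₄
  change rc ∉ IsLocalRing.maximalIdeal ℤ_[ℓ] at hc₄
  rw [IsLocalRing.mem_maximalIdeal, PadicInt.mem_nonunits] at hc₄
  have hc₄' : ‖Wm.c₄‖ = 1 := by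
    rw [← hrc, ← PadicInt.norm_def]; exact le_antisymm (PadicInt.norm_le_one _) (not_lt.mp hc₄)
  -- `ord Δ(Wm) = ord Δ(E)` (both minimal), so the minimising `u` is a unit
  have hΔ : E.Δ ≠ 0 := by
    rw [hE, baseChange, map_Δ]
    exact (map_ne_zero _).mpr W.isUnit_Δ.ne_zero
  have hval : Wm.Δ.valuation = E.Δ.valuation := padicValuation_Δ_minimal_eq E hΔ
  have hΔm : Wm.Δ ≠ 0 := by
    rw [hWm, WeierstrassCurve.minimal, variableChange_Δ]
    exact mul_ne_zero (pow_ne_zero _ (Units.ne_zero _)) hΔ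
  have hnormΔ : ‖Wm.Δ‖ = ‖E.Δ‖ := by
    rw [Padic.norm_eq_zpow_neg_valuation hΔm, Padic.norm_eq_zpow_neg_valuation hΔ, hval]
  set Cm : VariableChange ℚ_[ℓ] := (E.exists_isMinimal ℤ_[ℓ]).choose with hCm
  have hWmE : Wm = Cm • E := rfl
  have hu : ‖((Cm.u⁻¹ : ℚ_[ℓ]ˣ) : ℚ_[ℓ])‖ = 1 := by
    have h12 : ‖((Cm.u⁻¹ : ℚ_[ℓ]ˣ) : ℚ_[ℓ])‖ ^ 12 = 1 := by
      have h1 := congrArg (‖·‖) (show Wm.Δ = _ from by rw [hWmE, variableChange_Δ])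
      simp only [norm_mul, norm_pow] at h1
      rw [hnormΔ] at h1
      have hΔpos : ‖E.Δ‖ ≠ 0 := norm_ne_zero_iff.mpr hΔ
      exact (mul_right_cancel₀ hΔpos (h1.symm.trans (one_mul _).symm))
    exact (pow_eq_one_iff_of_nonneg (norm_nonneg _) (by norm_num)).mp h12
  have hc₄E : ‖E.c₄‖ = 1 := by
    have h1 := congrArg (‖·‖) (show Wm.c₄ = _ from by rw [hWmE, variableChange_c₄])
    simp only [norm_mul, norm_pow, hu, one_pow, one_mul] at h1
    rw [← h1, hc₄']
  have hEc : E.c₄ = (W.c₄ : ℚ_[ℓ]) := by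
    show (W.map (algebraMap ℚ ℚ_[ℓ])).c₄ = _
    rw [map_c₄, eq_ratCast]
  rw [← hEc]; exact hc₄E

/-! ### Transport of `tateJ` and of the curve to `ℂ_p` -/

/-- `‖(x : ℂ_p)‖ = ‖x‖_p`. [folklore] -/
private theorem norm_coe_padicComplex (x : ℚ_[p]) : ‖(algebraMap ℚ_[p] ℂ_[p] x)‖ = ‖x‖ :=
  norm_algebraMap' ℂ_[p] x

/-- **`tateJ` commutes with `ℚ_p → ℂ_p`**: `tateJ (q : ℂ_p) = (tateJ q : ℂ_p)` for `‖q‖ < 1`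
(`j(E_q) = tateJ q` on both sides, `(E_q).map ι = E_{ιq}`).
[cite: SilvermanATAEC1994, Thm. V.3.1 (b),(d) (PDF pp. 395, 399)] -/
theorem tateJ_algebraMap_padicComplex {q : ℚ_[p]} (hq0 : q ≠ 0) (hq : ‖q‖ < 1) :
    tateJ (algebraMap ℚ_[p] ℂ_[p] q) = algebraMap ℚ_[p] ℂ_[p] (tateJ q) := by
  have hq' : ‖algebraMap ℚ_[p] ℂ_[p] q‖ < 1 := by rw [norm_coe_padicComplex]; exact hq
  have hq0' : algebraMap ℚ_[p] ℂ_[p] q ≠ 0 := (map_ne_zero _).mpr hq0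
  haveI := tateCurve_isElliptic hq0 hq
  haveI := tateCurve_isElliptic hq0' hq'
  have hmap : (tateCurve q).map (algebraMap ℚ_[p] ℂ_[p]) = tateCurve (algebraMap ℚ_[p] ℂ_[p] q) :=
    tateCurve_map _ (continuous_algebraMap ℚ_[p] ℂ_[p]) hq
  rw [← tateCurve_j hq, ← map_j (tateCurve q) (algebraMap ℚ_[p] ℂ_[p])]
  -- `j` only depends on the curve, not on the `IsElliptic` witness
  have : ∀ (E₁ E₂ : WeierstrassCurve ℂ_[p]) [E₁.IsElliptic] [E₂.IsElliptic], E₁ = E₂ → E₁.j = E₂.j := by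
    rintro E₁ E₂ _ _ rfl; rfl
  rw [this _ _ hmap, tateCurve_j hq']

/-! ### The integral isomorphism over `ℂ_p` -/

/-- **An INTEGRAL isomorphism `C • (W ⊗ ℂ_p) = E_q` at a multiplicative prime `p ≠ 2`.** For `W/ℚ`
globally minimal with multiplicative reduction at `p` and `q ∈ ℚ_p`, `0 < ‖q‖ < 1`, `tateJ q = j(W)`:
over `ℂ_p` there is `C = (u,r,s,t)` with `C • (W ⊗ ℂ_p) = E_q`, `‖u‖ = 1`, `‖r‖, ‖s‖, ‖t‖ ≤ 1`.
Existence: Lemma V.5.2 (b) (`iso_tateCurve_of_isSquare_gamma`; `γ` is a square as `ℂ_p` is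
algebraically closed). Integrality: `u⁻⁴c₄(W) = c₄(E_q) = E₄(q)` with `‖c₄(W)‖ = ‖E₄(q)‖ = 1`;
`4r³ + b₂r² + 2b₄r + b₆ = u⁶b₆(E_q)` forces `‖r‖ ≤ 1` (ultrametric, `‖4‖ = 1`); then
`2s = u − a₁`, `2t = −a₃ − ra₁`. [Silverman ATAEC Lemma V.5.2 (b), Thm. V.5.3; AEC III.1 Table 3.1]
[cite: SilvermanATAEC1994, Lemma V.5.2 (b) and Thm. V.5.3 (PDF pp. 406–409)]
[cite: SilvermanAEC2009, III.1 Table 3.1] -/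
theorem exists_integral_variableChange_padicComplex [W.IsElliptic] [W.IsGloballyMinimal]
    (hp2 : p ≠ 2) (hmult : W.HasMultiplicativeReductionAtPrime p) {q : ℚ_[p]} (hq0 : q ≠ 0)
    (hq : ‖q‖ < 1) (hj : tateJ q = (W.j : ℚ_[p])) :
    ∃ C : VariableChange ℂ_[p],
      C • (W.baseChange ℚ_[p]).map (algebraMap ℚ_[p] ℂ_[p]) = tateCurve (algebraMap ℚ_[p] ℂ_[p] q) ∧
      ‖(C.u : ℂ_[p])‖ = 1 ∧ ‖C.r‖ ≤ 1 ∧ ‖C.s‖ ≤ 1 ∧ ‖C.t‖ ≤ 1 := by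
  set ι := algebraMap ℚ_[p] ℂ_[p] with hι
  have hnι : ∀ x : ℚ_[p], ‖ι x‖ = ‖x‖ := fun x => norm_algebraMap' ℂ_[p] x
  set E₀ : WeierstrassCurve ℚ_[p] := W.baseChange ℚ_[p] with hE₀
  set E : WeierstrassCurve ℂ_[p] := E₀.map ι with hE
  have hq' : ‖ι q‖ < 1 := by rw [hnι]; exact hq
  have hq0' : ι q ≠ 0 := (map_ne_zero _).mpr hq0
  -- integrality of `E₀` and `E`
  haveI : E₀.IsIntegral ℤ_[p] := by rw [hE₀]; infer_instance
  obtain ⟨ha₁, ha₂, ha₃, ha₄, ha₆⟩ := E₀.norm_coeffs_le_one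
  have hEa₁ : ‖E.a₁‖ ≤ 1 := by rw [show E.a₁ = ι E₀.a₁ from rfl, hnι]; exact ha₁
  have hEa₃ : ‖E.a₃‖ ≤ 1 := by rw [show E.a₃ = ι E₀.a₃ from rfl, hnι]; exact ha₃
  have hib : ∀ x y : ℂ_[p], ‖x‖ ≤ 1 → ‖y‖ ≤ 1 → ‖x + y‖ ≤ 1 := fun x y hx hy =>
    (IsUltrametricDist.norm_add_le_max _ _).trans (max_le hx hy)
  have him : ∀ x y : ℂ_[p], ‖x‖ ≤ 1 → ‖y‖ ≤ 1 → ‖x * y‖ ≤ 1 := fun x y hx hy => by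
    rw [norm_mul]; exact mul_le_one₀ hx (norm_nonneg _) hy
  have hnat : ∀ n : ℕ, ‖(n : ℂ_[p])‖ ≤ 1 := fun n => IsUltrametricDist.norm_natCast_le_one ℂ_[p] n
  have hEa₂ : ‖E.a₂‖ ≤ 1 := by rw [show E.a₂ = ι E₀.a₂ from rfl, hnι]; exact ha₂
  have hEa₄ : ‖E.a₄‖ ≤ 1 := by rw [show E.a₄ = ι E₀.a₄ from rfl, hnι]; exact ha₄
  have hEa₆ : ‖E.a₆‖ ≤ 1 := by rw [show E.a₆ = ι E₀.a₆ from rfl, hnι]; exact ha₆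
  have hEb₂ : ‖E.b₂‖ ≤ 1 := by
    rw [WeierstrassCurve.b₂]; exact hib _ _ (by rw [sq]; exact him _ _ hEa₁ hEa₁) (him _ _ (hnat 4) hEa₂)
  have hEb₄ : ‖E.b₄‖ ≤ 1 := by
    rw [WeierstrassCurve.b₄]; exact hib _ _ (him _ _ (hnat 2) hEa₄) (him _ _ hEa₁ hEa₃)
  have hEb₆ : ‖E.b₆‖ ≤ 1 := by
    rw [WeierstrassCurve.b₆]; exact hib _ _ (by rw [sq]; exact him _ _ hEa₃ hEa₃) (him _ _ (hnat 4) hEa₆)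
  -- `j`, `γ`
  have hWj := one_lt_norm_j_of_hasMultiplicativeReductionAtPrime (W := W) (p := p) hmult
  have hE₀j : E₀.j = (W.j : ℚ_[p]) := by
    show (W.map (algebraMap ℚ ℚ_[p])).j = _
    rw [WeierstrassCurve.map_j, eq_ratCast]
  have hEj : E.j = ι (W.j : ℚ_[p]) := by
    have h := WeierstrassCurve.map_j E₀ ι
    rw [hE₀j] at h
    exact h
  have hj1 : 1 < ‖E.j‖ := by rw [hEj, hnι]; exact hWj
  have hqj : tateJ (ι q) = E.j := by rw [tateJ_algebraMap_padicComplex hq0 hq, hj, hEj]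
  have hγ : IsSquare (-(E.c₄ / E.c₆)) := by
    obtain ⟨z, hz⟩ := IsAlgClosed.exists_pow_nat_eq (-(E.c₄ / E.c₆)) two_pos
    exact ⟨z, by rw [← hz, sq]⟩
  obtain ⟨C, hC⟩ := iso_tateCurve_of_isSquare_gamma E hj1 hq0' hq' hqj hγ
  -- `‖u‖ = 1`
  have h2 : ‖(2 : ℂ_[p])‖ = 1 := PadicAlgebra.norm_two_eq_one (p := p) hp2
  have h4 : ‖(4 : ℂ_[p])‖ = 1 := by
    rw [show (4 : ℂ_[p]) = 2 * 2 by norm_num, norm_mul, h2, one_mul]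
  have hc₄W : ‖E.c₄‖ = 1 := by
    have hE₀c : E₀.c₄ = (W.c₄ : ℚ_[p]) := by
      show (W.map (algebraMap ℚ ℚ_[p])).c₄ = _
      rw [map_c₄, eq_ratCast]
    rw [show E.c₄ = ι E₀.c₄ from map_c₄ E₀ ι, hnι, hE₀c]
    exact norm_c₄_eq_one_of_hasMultiplicativeReductionAtPrime hmult
  have hui : ‖((C.u⁻¹ : ℂ_[p]ˣ) : ℂ_[p])‖ = 1 := by
    have h := congrArg (‖·‖) (variableChange_c₄ E C)
    simp only [hC, tateCurve_c₄, norm_tateE4_eq_one hq', norm_mul, norm_pow, hc₄W, mul_one] at h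
    exact ((pow_eq_one_iff_of_nonneg (norm_nonneg _) (by norm_num)).mp h.symm)
  have hu : ‖(C.u : ℂ_[p])‖ = 1 := by
    rw [Units.val_inv_eq_inv_val, norm_inv] at hui; exact inv_eq_one.mp hui
  -- `‖r‖ ≤ 1` from the `b₆` relation
  have hr : ‖C.r‖ ≤ 1 := by
    by_contra hr
    push Not at hr
    have hb := variableChange_b₆ E C
    rw [hC, tateCurve_b₆] at hb
    -- `4 a₆(q) = u⁻⁶ (b₆ + 2 r b₄ + r² b₂ + 4 r³)`
    have hr0 : 0 < ‖C.r‖ := one_pos.trans hr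
    have hA : ‖E.b₆ + 2 * C.r * E.b₄ + C.r ^ 2 * E.b₂‖ < ‖4 * C.r ^ 3‖ := by
      rw [norm_mul, h4, one_mul, norm_pow]
      have hr2 : ‖C.r‖ ^ 2 < ‖C.r‖ ^ 3 := by
        rw [show ‖C.r‖ ^ 3 = ‖C.r‖ ^ 2 * ‖C.r‖ by ring]
        exact lt_mul_of_one_lt_right (pow_pos hr0 2) hr
      have hr1 : ‖C.r‖ < ‖C.r‖ ^ 3 := by
        calc ‖C.r‖ = ‖C.r‖ ^ 1 := (pow_one _).symm
          _ < ‖C.r‖ ^ 3 := pow_lt_pow_right₀ hr (by norm_num)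
      refine (IsUltrametricDist.norm_add_le_max _ _).trans_lt (max_lt ?_ ?_)
      · refine (IsUltrametricDist.norm_add_le_max _ _).trans_lt (max_lt ?_ ?_)
        · exact hEb₆.trans_lt (by calc (1 : ℝ) = 1 ^ 3 := (one_pow 3).symm
            _ < ‖C.r‖ ^ 3 := pow_lt_pow_left₀ hr zero_le_one (by norm_num))
        · rw [norm_mul, norm_mul, h2, one_mul]
          calc ‖C.r‖ * ‖E.b₄‖ ≤ ‖C.r‖ * 1 := mul_le_mul_of_nonneg_left hEb₄ hr0.le
            _ = ‖C.r‖ := mul_one _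
            _ < ‖C.r‖ ^ 3 := hr1
      · rw [norm_mul, norm_pow]
        calc ‖C.r‖ ^ 2 * ‖E.b₂‖ ≤ ‖C.r‖ ^ 2 * 1 := mul_le_mul_of_nonneg_left hEb₂ (sq_nonneg _)
          _ = ‖C.r‖ ^ 2 := mul_one _
          _ < ‖C.r‖ ^ 3 := hr2
    have hsum : ‖E.b₆ + 2 * C.r * E.b₄ + C.r ^ 2 * E.b₂ + 4 * C.r ^ 3‖ = ‖4 * C.r ^ 3‖ := by
      rw [IsUltrametricDist.norm_add_eq_max_of_norm_ne_norm hA.ne, max_eq_right hA.le]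
    have hlhs : ‖(4 : ℂ_[p]) * tateA6 (ι q)‖ ≤ 1 := by
      rw [norm_mul, h4, one_mul]
      exact (norm_tateA6_le hq' (by norm_num)).trans hq'.le
    have hbig : 1 < ‖4 * C.r ^ 3‖ := by
      rw [norm_mul, h4, one_mul, norm_pow]
      calc (1 : ℝ) = 1 ^ 3 := (one_pow 3).symm
        _ < ‖C.r‖ ^ 3 := pow_lt_pow_left₀ hr zero_le_one (by norm_num)
    have hR : ‖((C.u⁻¹ : ℂ_[p]ˣ) : ℂ_[p]) ^ 6 *
        (E.b₆ + 2 * C.r * E.b₄ + C.r ^ 2 * E.b₂ + 4 * C.r ^ 3)‖ = ‖4 * C.r ^ 3‖ := by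
      rw [norm_mul, norm_pow, hui, one_pow, one_mul, hsum]
    rw [← hb] at hR
    rw [hR] at hlhs
    exact absurd hlhs (not_le.mpr hbig)
  -- `‖s‖ ≤ 1`, `‖t‖ ≤ 1`
  have e₁ : (C • E).a₁ = 1 := by rw [hC]; rfl
  have e₃ : (C • E).a₃ = 0 := by rw [hC]; rfl
  rw [variableChange_a₁] at e₁
  rw [variableChange_a₃] at e₃
  have hs2 : 2 * C.s = (C.u : ℂ_[p]) - E.a₁ := by
    have h := congrArg (fun z => (C.u : ℂ_[p]) * z) e₁
    simp only [← mul_assoc, Units.mul_inv, one_mul, mul_one] at h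
    linear_combination h
  have ht2 : 2 * C.t = -(E.a₃ + C.r * E.a₁) := by
    have h := (mul_eq_zero.mp e₃).resolve_left (pow_ne_zero 3 (C.u⁻¹).ne_zero)
    linear_combination h
  have hs : ‖C.s‖ ≤ 1 := by
    have hn : ‖2 * C.s‖ ≤ 1 := by
      rw [hs2, sub_eq_add_neg]
      exact hib _ _ hu.le (by rw [norm_neg]; exact hEa₁)
    rwa [norm_mul, h2, one_mul] at hn
  have ht : ‖C.t‖ ≤ 1 := by
    have hn : ‖2 * C.t‖ ≤ 1 := by
      rw [ht2, norm_neg]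
      exact hib _ _ hEa₃ (him _ _ hr hEa₁)
    rwa [norm_mul, h2, one_mul] at hn
  exact ⟨C, hC, hu, hr, hs, ht⟩

end Literature.NumberTheory.EllipticCurves.SteinWuthrich2013

end
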